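import Summits.ABC.ABC.Theses.OmegaSplitFewPrime
import Summits.ABC.ABC.Theses.LopsidedSzpiroSplit
import Summits.ABC.ABC.Theorems.DeepRegimeABC.Negative.ConstFreeFloors
import Literature.NumberTheory.DiophantineGeometry.AbcWave0QualityFormProofs

/-!
# Crux-strategist s2 (2026-08-17) — `DeepRegimeABC` (stmt-ABC-15121) in the new route context
`route-ABC-OmegaSplitFewPrime` (ω-split: `ThreeSlotABC → FewPrimeUniformABC → DeepRegimeABC → ABC`)

Kernel-checked support for the s2 section of `Cruxes/DeepRegimeABC/STRATEGY-CENSUS.md`.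
Nothing here is a route item; nothing is proposed to `Theorems/`.  `X` := the crux

  `DeepRegimeABC := ∀ ε > 0, ∃ K C, 0 < C ∧ ∀ abc triples, ω₅(abc) ≥ K → c < C·rad(abc)^(1+ε)`,
  `ω₅(n) := #{p : v_p(n) ≥ 5}`.

## §D11  Szpiro-tail split (decomposition attempt native to `route-ABC-LopsidedSzpiroSplit`)

* `XLopTail`  := X restricted to LOPSIDED deep-tail triples (`min(a,b) ≤ c^(1-ε)`);
* `XSextTail` := Szpiro exponent `6+ε` for `a·b·c⁴` (the 2-isogenous Frey codomain discriminant, up to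
  `2⁸`) on the deep tail.

Proved: `XLopTail → XSextTail → X` (port of `LopsidedSzpiroSplit.closes`), `X → XLopTail`,
`X → XSextTail` (so the split is LOSSLESS: `X ↔ XLopTail ∧ XSextTail`), and the dominations
`LopsidedABC → XLopTail`, `SexticABC → XSextTail` by the two STAFFED cruxes stmt-ABC-18360 / 18361.
Bare probes `XLopTail → X`, `XSextTail → X`, `· → ABC` all FAIL (`ProbesS2.lean`, rc 1 by design).
Verdict in the census: passes (a)(b)(c) of the decomposition certificate, fails (d) — neither piece has
an engine-bearing skeleton; their only "plan" is domination by items whose own strategist censuses are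
`no-strategy-short-of-summit` (Cruxes/LopsidedABC/STRATEGY-CENSUS.md) — so it is RECORDED, NOT FILED.

## §S7  Robert–Stewart–Tenenbaum-shaped strengthening

* `XRST C` := every abc triple with `ω₅ ≥ 1` has `c ≤ rad^(1 + C/√ω₅)` (quality `≤ 1 + C/√ω₅`).

Proved: `0 ≤ C → XRST C → X` (threshold `K(ε) = ⌈(C/ε)²⌉ + 1`), and `¬ XRST 1` from the
Browkin–Brzeziński triple (`ω₅ ≥ 3`, quality `1.6235 > 1 + 1/√3 = 1.5774`; kernel arithmetic via
`Negative.not_constFreeCell_three`).  `XRST 1.1` is consistent with every certified record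
(`(q−1)·√ω₅ ≤ 1.08` over Reyssat / BB / Nitaj / the c5 deep-cell census), but `XRST C` has no induction
variable and no engine: it is the crux with an explicit `K(ε)`, i.e. ABOVE the summit on its cell
(`OmegaLift.abc_of_manyPrimes` pattern) — no teeth.
-/

set_option linter.dupNamespace false
set_option linter.unusedVariables false

namespace Summit.ABC.ABC.Cruxes.DeepRegimeABC.StrategistS2

open Literature.NumberTheory.DiophantineGeometry
open Summit.ABC.ABC.Theses.OmegaSplitFewPrime (DeepRegimeABC)
open Summit.ABC.ABC.Theses.LopsidedSzpiroSplit (LopsidedABC SexticABC)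

/-! ### §D11 the two tail pieces -/

/-- D11(i): abc with constant on LOPSIDED deep-tail triples. [strategist s2] -/
def XLopTail : Prop :=
  ∀ ε : ℝ, 0 < ε → ∃ K : ℕ, ∃ C : ℝ, 0 < C ∧ ∀ a b c : ℕ, IsABCTriple a b c →
    K ≤ ((a * b * c).primeFactors.filter (fun p => 5 ≤ (a * b * c).factorization p)).card →
    ((min a b : ℕ) : ℝ) ≤ (c : ℝ) ^ (1 - ε) →
    (c : ℝ) < C * ((rad a b c : ℕ) : ℝ) ^ (1 + ε)

/-- D11(ii): Szpiro exponent `6 + ε` for `a·b·c⁴` on the deep tail. [strategist s2] -/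
def XSextTail : Prop :=
  ∀ ε : ℝ, 0 < ε → ∃ K : ℕ, ∃ C : ℝ, 0 < C ∧ ∀ a b c : ℕ, IsABCTriple a b c →
    K ≤ ((a * b * c).primeFactors.filter (fun p => 5 ≤ (a * b * c).factorization p)).card →
    ((a * b * c ^ 4 : ℕ) : ℝ) < C * ((rad a b c : ℕ) : ℝ) ^ (6 + ε)

/-- **D11 glue** `XLopTail → XSextTail → DeepRegimeABC`: port of `LopsidedSzpiroSplit.closes`
(δ := min ε 1; lopsided tail triples by `XLopTail`; on balanced ones `c^(6-δ)/2 < a·b·c⁴ < C₂·rad^(6+δ)`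
and `(1+δ)(6-δ) ≥ 6+δ`), with the depth threshold `K := max K₁ K₂`. [strategist s2] -/
theorem deepRegimeABC_of_lopTail_of_sextTail (hL : XLopTail) (hS : XSextTail) : DeepRegimeABC := by
  intro ε hε
  set δ : ℝ := min ε 1 with hδdef
  have hδ : 0 < δ := lt_min hε one_pos
  have hδ1 : δ ≤ 1 := min_le_right _ _
  have hδε : δ ≤ ε := min_le_left _ _
  obtain ⟨K1, C1, hK1, h1⟩ := hL δ hδ
  obtain ⟨K2, C2, hK2, h2⟩ := hS δ hδ
  refine ⟨max K1 K2, max C1 (2 * C2 + 1), lt_max_of_lt_left hK1, ?_⟩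
  intro a b c habc hdepth
  have hd1 : K1 ≤ ((a * b * c).primeFactors.filter (fun p => 5 ≤ (a * b * c).factorization p)).card :=
    le_trans (le_max_left _ _) hdepth
  have hd2 : K2 ≤ ((a * b * c).primeFactors.filter (fun p => 5 ≤ (a * b * c).factorization p)).card :=
    le_trans (le_max_right _ _) hdepth
  obtain ⟨ha, hb, hab, hcop⟩ := habc
  have hcpos : 0 < c := by omega
  have hc : (0 : ℝ) < (c : ℝ) := by exact_mod_cast hcpos
  have hradne : rad a b c ≠ 0 := by
    rw [rad_def]
    exact UniqueFactorizationMonoid.radical_ne_zero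
  have hR1 : (1 : ℝ) ≤ ((rad a b c : ℕ) : ℝ) := by
    exact_mod_cast Nat.one_le_iff_ne_zero.mpr hradne
  have hR0 : (0 : ℝ) < ((rad a b c : ℕ) : ℝ) := lt_of_lt_of_le one_pos hR1
  set R : ℝ := ((rad a b c : ℕ) : ℝ) with hRdef
  have hRδε : R ^ (1 + δ) ≤ R ^ (1 + ε) :=
    Real.rpow_le_rpow_of_exponent_le hR1 (by linarith)
  have hC1 : C1 ≤ max C1 (2 * C2 + 1) := le_max_left _ _
  have hC2 : 2 * C2 + 1 ≤ max C1 (2 * C2 + 1) := le_max_right _ _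
  by_cases hcase : ((min a b : ℕ) : ℝ) ≤ (c : ℝ) ^ (1 - δ)
  · -- lopsided tail triple
    have := h1 a b c ⟨ha, hb, hab, hcop⟩ hd1 hcase
    calc (c : ℝ) < C1 * R ^ (1 + δ) := this
      _ ≤ C1 * R ^ (1 + ε) := by gcongr
      _ ≤ max C1 (2 * C2 + 1) * R ^ (1 + ε) := by gcongr
  · -- balanced tail triple: use XSextTail
    push Not at hcase
    have hmM : min a b * max a b = a * b := min_mul_max a b
    have hmle : min a b ≤ max a b := min_le_max
    have h2M : c ≤ 2 * max a b := by omega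
    have hmM' : ((min a b : ℕ) : ℝ) * ((max a b : ℕ) : ℝ) = (a : ℝ) * (b : ℝ) := by
      exact_mod_cast hmM
    have h2M' : (c : ℝ) ≤ 2 * ((max a b : ℕ) : ℝ) := by exact_mod_cast h2M
    have hS' := h2 a b c ⟨ha, hb, hab, hcop⟩ hd2
    have hcast : ((a * b * c ^ 4 : ℕ) : ℝ) = (a : ℝ) * (b : ℝ) * (c : ℝ) ^ (4 : ℕ) := by
      push_cast; ring
    rw [hcast] at hS'
    have hpow : (c : ℝ) ^ (6 - δ) = (c : ℝ) ^ (1 - δ) * (c : ℝ) * (c : ℝ) ^ (4 : ℕ) := by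
      rw [← Real.rpow_natCast (c : ℝ) 4]
      rw [show (6 : ℝ) - δ = (1 - δ) + 1 + (4 : ℕ) by push_cast; ring]
      rw [Real.rpow_add hc, Real.rpow_add hc, Real.rpow_one]
    have hlow : (c : ℝ) ^ (6 - δ) < 2 * ((a : ℝ) * (b : ℝ) * (c : ℝ) ^ (4 : ℕ)) := by
      rw [hpow, ← hmM']
      have hc4 : (0 : ℝ) < (c : ℝ) ^ (4 : ℕ) := by positivity
      have hcδ : (0 : ℝ) < (c : ℝ) ^ (1 - δ) := Real.rpow_pos_of_pos hc _
      have hMpos : (0 : ℝ) < ((max a b : ℕ) : ℝ) := by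
        have : 0 < max a b := lt_of_lt_of_le ha (le_max_left a b)
        exact_mod_cast this
      have hstep1 : (c : ℝ) ^ (1 - δ) * (c : ℝ) ≤ (c : ℝ) ^ (1 - δ) * (2 * ((max a b : ℕ) : ℝ)) :=
        mul_le_mul_of_nonneg_left h2M' hcδ.le
      have hstep2 : (c : ℝ) ^ (1 - δ) * (2 * ((max a b : ℕ) : ℝ))
          < ((min a b : ℕ) : ℝ) * (2 * ((max a b : ℕ) : ℝ)) :=
        mul_lt_mul_of_pos_right hcase (by positivity)
      have hstep3 : (c : ℝ) ^ (1 - δ) * (c : ℝ) < ((min a b : ℕ) : ℝ) * (2 * ((max a b : ℕ) : ℝ)) :=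
        lt_of_le_of_lt hstep1 hstep2
      have hstep4 := mul_lt_mul_of_pos_right hstep3 hc4
      calc (c : ℝ) ^ (1 - δ) * (c : ℝ) * (c : ℝ) ^ (4 : ℕ)
          < ((min a b : ℕ) : ℝ) * (2 * ((max a b : ℕ) : ℝ)) * (c : ℝ) ^ (4 : ℕ) := hstep4
        _ = 2 * (((min a b : ℕ) : ℝ) * ((max a b : ℕ) : ℝ) * (c : ℝ) ^ (4 : ℕ)) := by ring
    have hkey : (c : ℝ) ^ (6 - δ) < 2 * C2 * R ^ (6 + δ) := by nlinarith [hlow, hS']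
    by_contra hnot
    push Not at hnot
    set C' : ℝ := 2 * C2 + 1 with hC'def
    have hC'1 : (1 : ℝ) ≤ C' := by linarith
    have hC'0 : (0 : ℝ) ≤ C' := by linarith
    have hstep : C' * R ^ (1 + δ) ≤ (c : ℝ) := by
      calc C' * R ^ (1 + δ) ≤ max C1 (2 * C2 + 1) * R ^ (1 + ε) := by
            gcongr
        _ ≤ (c : ℝ) := hnot
    have hbase0 : (0 : ℝ) ≤ C' * R ^ (1 + δ) := by positivity
    have hraise : (C' * R ^ (1 + δ)) ^ (6 - δ) ≤ (c : ℝ) ^ (6 - δ) :=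
      Real.rpow_le_rpow hbase0 hstep (by linarith)
    have hsplit : (C' * R ^ (1 + δ)) ^ (6 - δ) = C' ^ (6 - δ) * R ^ ((1 + δ) * (6 - δ)) := by
      rw [Real.mul_rpow hC'0 (le_of_lt (Real.rpow_pos_of_pos hR0 _)), ← Real.rpow_mul (le_of_lt hR0)]
    have hCpow : C' ≤ C' ^ (6 - δ) := by
      calc C' = C' ^ (1 : ℝ) := (Real.rpow_one _).symm
        _ ≤ C' ^ (6 - δ) := Real.rpow_le_rpow_of_exponent_le hC'1 (by linarith)
    have hRpow : R ^ (6 + δ) ≤ R ^ ((1 + δ) * (6 - δ)) := by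
      apply Real.rpow_le_rpow_of_exponent_le hR1
      nlinarith
    have hR6 : (0 : ℝ) < R ^ (6 + δ) := Real.rpow_pos_of_pos hR0 _
    have hfin : C' * R ^ (6 + δ) ≤ (c : ℝ) ^ (6 - δ) := by
      calc C' * R ^ (6 + δ) ≤ C' ^ (6 - δ) * R ^ ((1 + δ) * (6 - δ)) := by
            gcongr
        _ = (C' * R ^ (1 + δ)) ^ (6 - δ) := hsplit.symm
        _ ≤ (c : ℝ) ^ (6 - δ) := hraise
    have hfin' : (2 * C2 + 1) * R ^ (6 + δ) ≤ (c : ℝ) ^ (6 - δ) := hfin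
    nlinarith [hkey, hfin', hR6]

/-- Sandwich (i): `DeepRegimeABC → XLopTail` (drop the lopsidedness hypothesis). [strategist s2] -/
theorem lopTail_of_deepRegimeABC (h : DeepRegimeABC) : XLopTail := by
  intro ε hε
  obtain ⟨K, C, hC, hK⟩ := h ε hε
  exact ⟨K, C, hC, fun a b c habc hd _ => hK a b c habc hd⟩

/-- Sandwich (ii): `DeepRegimeABC → XSextTail` (`a·b·c⁴ < c⁶ < C⁶·rad^(6+ε)` from X at `ε/6`), so the
D11 split is lossless: `X ↔ XLopTail ∧ XSextTail`. [strategist s2] -/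
theorem sextTail_of_deepRegimeABC (h : DeepRegimeABC) : XSextTail := by
  intro ε hε
  have hε6 : 0 < ε / 6 := by positivity
  obtain ⟨K, C, hC, hK⟩ := h (ε / 6) hε6
  refine ⟨K, C ^ (6 : ℕ), by positivity, ?_⟩
  intro a b c habc hd
  have hlt := hK a b c habc hd
  obtain ⟨ha, hb, hab, hcop⟩ := habc
  have hcpos : 0 < c := by omega
  have hc : (0 : ℝ) < (c : ℝ) := by exact_mod_cast hcpos
  have hac : a ≤ c := by omega
  have hbc : b ≤ c := by omega
  have hR0 : (0 : ℝ) ≤ ((rad a b c : ℕ) : ℝ) := Nat.cast_nonneg _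
  -- a b c⁴ ≤ c⁶
  have h6 : ((a * b * c ^ 4 : ℕ) : ℝ) ≤ (c : ℝ) ^ (6 : ℕ) := by
    have : a * b * c ^ 4 ≤ c ^ 6 := by
      calc a * b * c ^ 4 ≤ c * c * c ^ 4 := by gcongr
        _ = c ^ 6 := by ring
    exact_mod_cast this
  -- c⁶ < (C rad^(1+ε/6))⁶ = C⁶ rad^(6+ε)
  have hpow : (c : ℝ) ^ (6 : ℕ) < (C * ((rad a b c : ℕ) : ℝ) ^ (1 + ε / 6)) ^ (6 : ℕ) := by
    exact pow_lt_pow_left₀ hlt hc.le (by norm_num)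
  have hsplit : (C * ((rad a b c : ℕ) : ℝ) ^ (1 + ε / 6)) ^ (6 : ℕ)
      = C ^ (6 : ℕ) * ((rad a b c : ℕ) : ℝ) ^ (6 + ε) := by
    rw [mul_pow, ← Real.rpow_natCast (((rad a b c : ℕ) : ℝ) ^ (1 + ε / 6)) 6,
      ← Real.rpow_mul hR0]
    congr 2
    push_cast; ring
  calc ((a * b * c ^ 4 : ℕ) : ℝ) ≤ (c : ℝ) ^ (6 : ℕ) := h6
    _ < (C * ((rad a b c : ℕ) : ℝ) ^ (1 + ε / 6)) ^ (6 : ℕ) := hpow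
    _ = C ^ (6 : ℕ) * ((rad a b c : ℕ) : ℝ) ^ (6 + ε) := hsplit

/-- Domination (i): the staffed crux `LopsidedABC` (stmt-ABC-18360) gives `XLopTail` (`K := 0`).
[strategist s2] -/
theorem lopTail_of_lopsidedABC (h : LopsidedABC) : XLopTail := by
  intro ε hε
  obtain ⟨C, hC, hK⟩ := h ε hε
  exact ⟨0, C, hC, fun a b c habc _ hlop => hK a b c habc hlop⟩

/-- Domination (ii): the staffed crux `SexticABC` (stmt-ABC-18361) gives `XSextTail` (`K := 0`).
[strategist s2] -/
theorem sextTail_of_sexticABC (h : SexticABC) : XSextTail := by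
  intro ε hε
  obtain ⟨C, hC, hK⟩ := h ε hε
  exact ⟨0, C, hC, fun a b c habc _ => hK a b c habc⟩

/-! ### §S7 the RST-shaped strengthening -/

/-- S7: quality `≤ 1 + C/√ω₅` on every abc triple with `ω₅ ≥ 1`, in exponent currency.
[strategist s2; shape after Robert–Stewart–Tenenbaum 2014, Conj. A] -/
def XRST (C : ℝ) : Prop :=
  ∀ a b c : ℕ, IsABCTriple a b c →
    1 ≤ ((a * b * c).primeFactors.filter (fun p => 5 ≤ (a * b * c).factorization p)).card →
    (c : ℝ) ≤ ((rad a b c : ℕ) : ℝ) ^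
      (1 + C / Real.sqrt (((a * b * c).primeFactors.filter (fun p => 5 ≤ (a * b * c).factorization p)).card : ℝ))

/-- `XRST C → DeepRegimeABC` for `C ≥ 0`, with the explicit threshold `K(ε) := ⌈(C/ε)²⌉₊ + 1`
(so `C/√ω₅ ≤ ε` once `ω₅ ≥ K`) and constant `2`. [strategist s2] -/
theorem deepRegimeABC_of_xRST {C : ℝ} (hC : 0 ≤ C) (h : XRST C) : DeepRegimeABC := by
  intro ε hε
  refine ⟨⌈(C / ε) ^ 2⌉₊ + 1, 2, by norm_num, ?_⟩
  intro a b c habc hd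
  set d : ℕ := ((a * b * c).primeFactors.filter (fun p => 5 ≤ (a * b * c).factorization p)).card
    with hddef
  have hd1 : 1 ≤ d := le_trans (Nat.le_add_left 1 _) hd
  have hle := h a b c habc hd1
  have hradne : rad a b c ≠ 0 := by
    rw [rad_def]
    exact UniqueFactorizationMonoid.radical_ne_zero
  have hR1 : (1 : ℝ) ≤ ((rad a b c : ℕ) : ℝ) := by
    exact_mod_cast Nat.one_le_iff_ne_zero.mpr hradne
  have hR0 : (0 : ℝ) < ((rad a b c : ℕ) : ℝ) := lt_of_lt_of_le one_pos hR1
  -- (C/ε)² ≤ d, hence C/ε ≤ √d, hence C/√d ≤ ε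
  have hdreal : (C / ε) ^ 2 ≤ (d : ℝ) := by
    have h1 : ((C / ε) ^ 2 : ℝ) ≤ (⌈(C / ε) ^ 2⌉₊ : ℝ) := Nat.le_ceil _
    have h2 : ((⌈(C / ε) ^ 2⌉₊ : ℕ) : ℝ) ≤ (d : ℝ) := by
      exact_mod_cast le_trans (Nat.le_succ _) hd
    linarith
  have hCε : 0 ≤ C / ε := div_nonneg hC hε.le
  have hsqrt : C / ε ≤ Real.sqrt d := (Real.le_sqrt hCε (Nat.cast_nonneg _)).mpr hdreal
  have hdpos : (0 : ℝ) < Real.sqrt d := by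
    rw [Real.sqrt_pos]
    exact_mod_cast hd1
  have hexp : C / Real.sqrt d ≤ ε := by
    rw [div_le_iff₀ hdpos]
    calc C = ε * (C / ε) := by field_simp
      _ ≤ ε * Real.sqrt d := by gcongr
  have hmono : ((rad a b c : ℕ) : ℝ) ^ (1 + C / Real.sqrt d) ≤ ((rad a b c : ℕ) : ℝ) ^ (1 + ε) :=
    Real.rpow_le_rpow_of_exponent_le hR1 (by linarith)
  have hpos : (0 : ℝ) < ((rad a b c : ℕ) : ℝ) ^ (1 + ε) := Real.rpow_pos_of_pos hR0 _
  calc (c : ℝ) ≤ ((rad a b c : ℕ) : ℝ) ^ (1 + C / Real.sqrt d) := hle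
    _ ≤ ((rad a b c : ℕ) : ℝ) ^ (1 + ε) := hmono
    _ < 2 * ((rad a b c : ℕ) : ℝ) ^ (1 + ε) := by linarith

/-- `XRST 1` implies the constant-free cell statement `ConstFreeCell(3, 0.6)` (`1/√3 < 0.6`).
[strategist s2] -/
theorem constFreeCell_three_of_xRST_one (h : XRST 1) :
    ∀ a b c : ℕ, IsABCTriple a b c →
      3 ≤ ((a * b * c).primeFactors.filter (fun p => 5 ≤ (a * b * c).factorization p)).card →
      (c : ℝ) < ((rad a b c : ℕ) : ℝ) ^ (1 + (0.6 : ℝ)) := by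
  intro a b c habc hd
  set d : ℕ := ((a * b * c).primeFactors.filter (fun p => 5 ≤ (a * b * c).factorization p)).card
    with hddef
  have hle := h a b c habc (le_trans (by norm_num) hd)
  have hR2 : (2 : ℝ) ≤ ((rad a b c : ℕ) : ℝ) := by exact_mod_cast habc.two_le_rad
  have hR1 : (1 : ℝ) < ((rad a b c : ℕ) : ℝ) := by linarith
  -- 1/√d ≤ 1/√3 < 0.6
  have h3 : (3 : ℝ) ≤ (d : ℝ) := by exact_mod_cast hd
  have hs3 : Real.sqrt 3 ≤ Real.sqrt d := Real.sqrt_le_sqrt h3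
  have hs3pos : (0 : ℝ) < Real.sqrt 3 := by rw [Real.sqrt_pos]; norm_num
  have h17 : (1.7 : ℝ) < Real.sqrt 3 := by
    rw [Real.lt_sqrt (by norm_num)]
    norm_num
  have hinv : 1 / Real.sqrt (d : ℝ) < (0.6 : ℝ) := by
    calc 1 / Real.sqrt (d : ℝ) ≤ 1 / Real.sqrt 3 := by
          gcongr
      _ < 1 / 1.7 := by gcongr
      _ < 0.6 := by norm_num
  have hmono : ((rad a b c : ℕ) : ℝ) ^ (1 + 1 / Real.sqrt d) < ((rad a b c : ℕ) : ℝ) ^ (1 + (0.6 : ℝ)) :=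
    Real.rpow_lt_rpow_of_exponent_lt hR1 (by linarith)
  exact lt_of_le_of_lt hle hmono

/-- **`¬ XRST 1`**: the Browkin–Brzeziński triple `19·1307 + 7·29²·31⁸ = 2⁸·3²²·5⁴` (`ω₅ ≥ 3`,
quality `> 1.6234 > 1 + 1/√3`) refutes the RST shape with constant `1`
(`Negative.not_constFreeCell_three`). [strategist s2] -/
theorem not_xRST_one : ¬ XRST 1 := fun h =>
  Summit.ABC.ABC.Theorems.DeepRegimeABC.Negative.not_constFreeCell_three (ε := 0.6) (by norm_num)
    (constFreeCell_three_of_xRST_one h)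

end Summit.ABC.ABC.Cruxes.DeepRegimeABC.StrategistS2
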